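import Summits.ResolutionOfSingularities.ResolutionOfSingularities.Theorems.EquisingularLiftEquisingularLiftNatDirectionChartData
import Literature.AlgebraicGeometry.Modules.FrameRestriction
import HarnessLib

/-!
# Route `EquisingularLift`, crux EL♮(3) (stmt-ResolutionOfSingularities-20148) — GENERIC CONORMAL FRAMES FROM REGULAR GENERATORS

res-rescue-typ-5 g3 (w45b pool hand; offered by signature 2026-08-27T23:34:54Z for res-type-027's C2 sub-brick B1b «conormal frame `[T̄_W]`»
and as the common core of res-D-pv-051's `exists_directionChartData` (p566xxx) and this seat's (C3-ii) `exists_dirLift_chartColumn` (p585658), which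
both inline it at `n = 2`). OURS; NOT a statement of any manuscript; AI-written, weaker than expert review. No `sorry`; standard axioms; DEF-FREE;
`--supports stmt-ResolutionOfSingularities-20148 --as helper`.

* `exists_conormalFrame_of_generators` — for a closed immersion `i : Z ⟶ X` (`X` locally Noetherian), an affine `V ⊆ X` and a weakly regular
  sequence `x : Fin n → Γ(X, V)` generating `ker(i♯)(V)`: ideal-module sections `s_j ↦ x_j` and a FRAME `e : 𝒪^n ≅ 𝒞|_{i⁻¹V}` of the conormal sheaf
  `𝒞 = i^*𝓘` whose basis sections are the unit sections `η(s_j)` (`exists_basis_sections_pullback_idealModule_eq` + `nonempty_free_iso_over_of_basis`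
  + `exists_frame_of_basis`).
* `exists_conormalFrame_of_generators_le` — the same frame RESTRICTED to any open `B ≤ i⁻¹V` (`restrictTrivialisation`), basis sections `η(s_j)|_B`.
* `exists_conormalFrame_of_generator` — the rank-one spelling (`n = 1`, one nonzerodivisor generator `T`), which is B1b's shape.
-/

noncomputable section

-- `TopCat.Presheaf`/`Scheme.Modules` are not reducible (as in Mathlib's `AlgebraicGeometry/Modules`).
set_option backward.isDefEq.respectTransparency false

open CategoryTheory CategoryTheory.Limits AlgebraicGeometry Opposite TopologicalSpace Topology
open Literature.AlgebraicGeometry.Modules Literature.AlgebraicGeometry.Morphisms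
open Literature.AlgebraicGeometry.Deformation Literature.AlgebraicGeometry.Motives
open Literature.AlgebraicGeometry.HodgeTheory Literature.AlgebraicGeometry.Resolution
open AlgebraicGeometry.Scheme.IdealSheafData

set_option linter.dupNamespace false -- mandated namespace `Summit.<Summit>.<Problem>` of this single-conjunct summit

namespace Summit.ResolutionOfSingularities.ResolutionOfSingularities.Cruxes.EquisingularLiftNat.Sections

open Summit.ResolutionOfSingularities.ResolutionOfSingularities.Cruxes.EquisingularLiftNat.P1VB

/-- **Conormal frame from regular generators.** For a closed immersion `i : Z ⟶ X` into a locally Noetherian scheme, an affine `V` and a weakly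
regular sequence `x` generating `ker(i♯)(V)`, the conormal sheaf `i^*𝓘` is framed on `i⁻¹V` by the unit sections of ideal-module sections reading
to `x`. [cite: Hartshorne1977, II.8 Thm. 8.17 (p. 178)] (OURS spelling; folklore) -/
theorem exists_conormalFrame_of_generators {X Z : Scheme.{0}} (i : Z ⟶ X) [IsClosedImmersion i] [IsLocallyNoetherian X]
    (V : X.affineOpens) {n : ℕ} (x : Fin n → Γ(X, (V : X.Opens)))
    (hreg : RingTheory.Sequence.IsWeaklyRegular Γ(X, (V : X.Opens)) (List.ofFn x))
    (hI : Ideal.span (Set.range x) = i.ker.ideal V) :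
    ∃ (s : Fin n → Γ(idealModule i, (V : X.Opens))) (e : SheafOfModules.free (Fin n) ≅ (conormalSheaf i).over (i ⁻¹ᵁ (V : X.Opens))),
      (∀ j, toRing (idealModuleι i) (V : X.Opens) (s j) = x j) ∧
      ∀ j, basisSection e j = unitSectionLE i (idealModule i) (le_refl _) (s j) := by
  obtain ⟨s, b, hs, hb⟩ := exists_basis_sections_pullback_idealModule_eq i V x hreg hI
  obtain ⟨e₀⟩ := nonempty_free_iso_over_of_basis (conormalSheaf i) (coh_conormalSheaf i).loc (V.2.preimage i) b
  obtain ⟨e, he⟩ := exists_frame_of_basis e₀ b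
  exact ⟨s, e, hs, fun j => (he j).trans (hb j)⟩

/-- **Restricted conormal frame.** The frame of `exists_conormalFrame_of_generators` restricted to an open `B ≤ i⁻¹V`: basis sections `η(s_j)|_B`.
[cite: Hartshorne1977, II.5 (p. 110)] (OURS spelling; folklore) -/
theorem exists_conormalFrame_of_generators_le {X Z : Scheme.{0}} (i : Z ⟶ X) [IsClosedImmersion i] [IsLocallyNoetherian X]
    (V : X.affineOpens) {n : ℕ} (x : Fin n → Γ(X, (V : X.Opens)))
    (hreg : RingTheory.Sequence.IsWeaklyRegular Γ(X, (V : X.Opens)) (List.ofFn x))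
    (hI : Ideal.span (Set.range x) = i.ker.ideal V) {B : Z.Opens} (hB : B ≤ i ⁻¹ᵁ (V : X.Opens)) :
    ∃ (s : Fin n → Γ(idealModule i, (V : X.Opens))) (e : SheafOfModules.free (Fin n) ≅ (conormalSheaf i).over B),
      (∀ j, toRing (idealModuleι i) (V : X.Opens) (s j) = x j) ∧
      ∀ j, basisSection e j = unitSectionLE i (idealModule i) hB (s j) := by
  obtain ⟨s, e, hs, he⟩ := exists_conormalFrame_of_generators i V x hreg hI
  refine ⟨s, SheafOfModules.restrictTrivialisation (R := Z.ringCatSheaf) (homOfLE hB) e, hs, fun j => ?_⟩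
  rw [basisSection_restrictTrivialisation, he, unitSectionLE, unitSectionLE]
  change (conormalSheaf i).presheaf.map (homOfLE hB).op ((conormalSheaf i).presheaf.map (homOfLE (le_refl _)).op _) = _
  rw [presheaf_map_map, Subsingleton.elim (homOfLE hB ≫ homOfLE (le_refl _)) (homOfLE hB)]
  rfl

/-- **Rank-one conormal frame from one regular generator** (B1b's shape): if `ker(i♯)(V) = (T)` with `T` a nonzerodivisor of `Γ(X, V)`, the
conormal LINE bundle `i^*𝓘` is framed on any open `B ≤ i⁻¹V` by `η(s)|_B` for an ideal-module section `s ↦ T`.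
[cite: Hartshorne1977, II.8 Thm. 8.17 (p. 178)] (OURS spelling; folklore) -/
theorem exists_conormalFrame_of_generator {X Z : Scheme.{0}} (i : Z ⟶ X) [IsClosedImmersion i] [IsLocallyNoetherian X]
    (V : X.affineOpens) (T : Γ(X, (V : X.Opens))) (hT : T ∈ nonZeroDivisors Γ(X, (V : X.Opens)))
    (hI : Ideal.span {T} = i.ker.ideal V) {B : Z.Opens} (hB : B ≤ i ⁻¹ᵁ (V : X.Opens)) :
    ∃ (s : Γ(idealModule i, (V : X.Opens))) (e : SheafOfModules.free (Fin 1) ≅ (conormalSheaf i).over B),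
      toRing (idealModuleι i) (V : X.Opens) s = T ∧ basisSection e 0 = unitSectionLE i (idealModule i) hB s := by
  have hreg : RingTheory.Sequence.IsWeaklyRegular Γ(X, (V : X.Opens)) (List.ofFn ![T]) := by
    rw [List.ofFn_succ, List.ofFn_zero]
    exact (RingTheory.Sequence.isWeaklyRegular_singleton_iff _ _).mpr
      (fun a b h => (mul_cancel_left_mem_nonZeroDivisors hT).mp (by simpa [smul_eq_mul, mul_comm] using h))
  have hI' : Ideal.span (Set.range ![T]) = i.ker.ideal V := by
    rw [← hI]; congr 1; ext a; simp
  obtain ⟨s, e, hs, he⟩ := exists_conormalFrame_of_generators_le i V ![T] hreg hI' hB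
  exact ⟨s 0, e, hs 0, he 0⟩

end Summit.ResolutionOfSingularities.ResolutionOfSingularities.Cruxes.EquisingularLiftNat.Sections

end
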